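import Literature.NumberTheory.NumberFields.AmbiguousClassNumberFormula
import Literature.NumberTheory.NumberFields.TotallyPositiveHilbert90
import HarnessLib

/-!
# Chevalley's ambiguous class number formula for the NARROW class group (genus theory with signatures):
# `#Cl⁺(L)^G · [L:K] · [E_K⁺ : E_K⁺ ∩ N_{L/K} L⁺] = h⁺(K) · ∏_𝔭 e_𝔭` for `L/K` cyclic, unramified at the infinite places

Topic `NumberTheory/NumberFields`; namespace `Literature.NumberTheory.NumberFields.AmbiguousClass` (that of the tree's wide formula
`AmbiguousClassNumberFormula.lean`).  THEOREM-ONLY file (no definition, no named fact, no instance, no `sorry`), written by the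
prover seat `cruxlead-stmt-BirchSwinnertonDyer-19573-w2` GEN 12 (cell `bsd-2adic`; `--supports` stmt-BirchSwinnertonDyer-19573; closes
nothing).  The narrow twin of Lang's Lemma 4.1 was declared missing in the tree («We do NOT formalise the narrow formula»,
`QuadraticExtensionEvenNarrowClassNumber.lean`); it is the per-layer input of narrow genus theory in the cyclotomic `ℤ₂`-towers of
totally real fields (the narrow rank certificate of `NarrowFukuda*`).  Part II of two: the ideal-group side; Part I =
`TotallyPositiveHilbert90.lean` (`H¹(G, L⁺) = 0`, the cohomology of the totally positive units `E⁺`).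

THE THEOREM (`ambiguousNarrowClassNumberFormula`).  `L/K` a cyclic extension of number fields, `G = Gal(L/K) = ⟨σ⟩`, UNRAMIFIED
AT THE INFINITE PLACES (Mathlib `IsUnramifiedAtInfinitePlaces K L`: no real place of `K` becomes complex in `L` — e.g. `L` totally
real).  Inside the ambient groups `Lˣ` and `𝓘_L = (FractionalIdeal (𝓞 L)⁰ L)ˣ` of the tree's index calculus put `L⁺ = ker(signHom L)`
(totally positive elements), `E = unitsE L` (`𝓞_Lˣ`), `E⁺ = E ⊓ L⁺`, `P⁺ = totPosPrincipalIdeals L = π(L⁺)` (`π : a ↦ (a)`),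
`E_K⁺ = E⁺ ⊓ Kˣ` (the totally positive units of `K` inside `Lˣ`), `N = N_G` (`Herbrand.norm`).  Then

  **`[z0 σ ⊤ P⁺ : P⁺] · [L : K] · [E_K⁺ : E_K⁺ ∩ N(L⁺)] = h⁺(K) · ∏_𝔭 e_𝔭(L/K)`**,

where `[z0 σ ⊤ P⁺ : P⁺] = #{c ∈ Cl⁺(L) = 𝓘_L/P⁺ : σc = c} = #Cl⁺(L)^G` is the number of AMBIGUOUS NARROW CLASSES (`I P⁺` is `σ`-fixed
iff `σI/I ∈ P⁺`), `h⁺(K) = narrowClassNumber K`, and `∏_𝔭 e_𝔭 = ∏ᶠ 𝔭, ramificationIdxIn 𝔭 (𝓞 L)` over the finite primes.  This is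
Gras's formula «in the restricted sense» / C.-F. Yu's Theorem 1.1 at the real cycle `𝔠̃ = ∞̃_r` in the unramified-at-infinity case (Yu's
base cycle `𝔠` is then the set of all real places of `K`; the archimedean factor of the wide formula is `1`).  The norm group met is
`N(L⁺)`, the norms of totally positive elements.

PROOF = Lang's four steps (tree `AmbiguousClassIndexFormula.lean`) run with `(Lˣ, E, P_L)` replaced by `(L⁺, E⁺, P⁺)`, the one new input
being `H¹(G, L⁺) = 0` (Part I, `exists_mem_ker_signHom_smul_div_eq`):
* §0 `P⁺` is `G`-stable; `ιP_K⁺ = π(K⁺)`.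
* §2 (1⁺) `[z0 σ ⊤ P : P] = [𝓘^G : P^G] · #Ĥ⁻¹(G, P)` for ANY `G`-stable `P ≤ 𝓘_L` (`H¹(G, 𝓘_L) = 0`, tree
  `AmbiguousIdeal.exists_smul_div_eq_of_norm_eq_one`).
* §3 (3⁺) `[P⁺^G : ιP_K⁺] = #Ĥ⁻¹(G, E⁺)` (Part I `relIndex_z0_kerSign_unitsPos_eq_h1`, along `π`);  (4⁺) `#Ĥ⁻¹(G, P⁺) = [E_K⁺ ∩ N(L⁺) : N E⁺]`
  (the norm map; kernel `{a ∈ L⁺ : N a = 1} = (σ − 1)L⁺` by Part I).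
* §5 `[𝓘^G : ιP_K⁺] = h⁺(K) · ∏ e_𝔭` (wide step (2) `relIndex_map_principals_z0_top_eq_mul` + `h⁺ = h · [P_K : P_K⁺]`) and the assembled
  FORMULA, with Part I's `#Ĥ⁰(G, E⁺) = [E_K⁺ ∩ N L⁺ : N E⁺] · [E_K⁺ : E_K⁺ ∩ N L⁺]` and `[L:K] · #Ĥ⁰(E⁺) = #Ĥ⁻¹(E⁺)`.

References: [Gras2003] G. Gras, *Class Field Theory*, II.6.2.3 (restricted sense), IV.4; [Yu2014AmbiguousClassNumberFormulas] C.-F. Yu,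
*Ambiguous class number formulas*, arXiv:1412.1458, Thm. 1.1 (held, p. 3); [Lang1990] Ch. 13 §4 Lemma 4.1 (PDF pp. 203–204, the four
steps); [Lemmermeyer2013AmbiguousClassNumberFormula] (elementary proof of the wide formula, held arXiv:1309.1071); [FrohlichTaylor1990]
Ch. V §1 (1.8)–(1.13) (narrow class group, signatures); [Childress2009] Ch. 4 §4.
-/

noncomputable section

open NumberField NumberField.InfinitePlace IsDedekindDomain FractionalIdeal
open scoped nonZeroDivisors Pointwise

namespace Literature.NumberTheory.NumberFields.AmbiguousClass

open Literature.NumberTheory.GaloisRepresentations Literature.NumberTheory.GaloisRepresentations.Herbrand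
  Literature.NumberTheory.GaloisRepresentations.MinkowskiUnit
  Literature.NumberTheory.GaloisRepresentations.CyclicNormIndex
  Literature.NumberTheory.NumberFields.AmbiguousIdeal

/-! ### Index bookkeeping -/

section Group

variable {G H : Type*} [Group G] [Group H]

/-- If `B ≤ A` and `ker f ∩ A ≤ B` then `[f(A) : f(B)] = [A : B]` (the private lemma of
`AmbiguousClassIndexFormula.lean` / `HilbertTheorem94.lean`, made available to the narrow files). [folklore] -/
private theorem relIndex_map_map_of_ker_inf_le (f : G →* H) {A B : Subgroup G} (hBA : B ≤ A)
    (hker : f.ker ⊓ A ≤ B) : (B.map f).relIndex (A.map f) = B.relIndex A := by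
  have hX : (B.map f).comap f ⊓ A = B ⊓ A := by
    ext x
    simp only [Subgroup.mem_inf, Subgroup.mem_comap, Subgroup.mem_map]
    constructor
    · rintro ⟨⟨b, hb, hbx⟩, hxA⟩
      have hk : x * b⁻¹ ∈ f.ker ⊓ A :=
        Subgroup.mem_inf.mpr ⟨by rw [MonoidHom.mem_ker, map_mul, map_inv, ← hbx, mul_inv_cancel],
          A.mul_mem hxA (A.inv_mem (hBA hb))⟩
      have := B.mul_mem (hker hk) hb
      rw [inv_mul_cancel_right] at this
      exact ⟨this, hxA⟩
    · rintro ⟨hxB, hxA⟩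
      exact ⟨⟨x, hxB, rfl⟩, hxA⟩
  rw [← Subgroup.relIndex_comap, ← Subgroup.inf_relIndex_right ((B.map f).comap f), hX,
    Subgroup.inf_relIndex_right]

end Group

variable {K L : Type} [Field K] [NumberField K] [Field L] [NumberField L] [Algebra K L]

/-! ### §0 The totally positive principal ideals `P⁺` under the Galois action; `ιP_K⁺ = π(K⁺)` -/

omit [NumberField K] in
/-- `P⁺ = π(L⁺)` (definition of `totPosPrincipalIdeals`). [cite: FrohlichTaylor1990, Ch. V §1 (P_N⁺), p. 163] -/
theorem totPosPrincipalIdeals_eq_map :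
    totPosPrincipalIdeals L = ((signHom L).ker).map (toPrincipalIdeal (𝓞 L) L) := rfl

omit [NumberField K] in
/-- **`P⁺` is `Gal(L/K)`-stable** (`σ(a) = (σa)` and `L⁺` is stable). [cite: FrohlichTaylor1990, Ch. V §1 (P_N⁺), p. 163] -/
theorem isStable_totPosPrincipalIdeals : IsStable (L ≃ₐ[K] L) (totPosPrincipalIdeals L) := by
  rintro g _ ⟨a, ha, rfl⟩
  exact ⟨g • a, isStable_ker_signHom g ha, toPrincipalIdeal_smul g a⟩

omit [NumberField K] in
/-- `ker π ∩ L⁺ = E⁺` (`ker π = 𝓞_Lˣ`). [cite: FrohlichTaylor1990, Ch. V §1 (1.10), p. 163] -/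
theorem ker_toPrincipalIdeal_inf_ker_signHom :
    (toPrincipalIdeal (𝓞 L) L).ker ⊓ (signHom L).ker = unitsE L ⊓ (signHom L).ker := by
  rw [ker_toPrincipalIdeal_eq_unitsE]

omit [NumberField L] in
/-- `ι(a𝓞_K) = a𝓞_L` on units of fractional ideals: `ι ∘ π_K = π_L ∘ (Kˣ ↪ Lˣ)`.
[cite: NeukirchANT1999, Ch. III §1 Prop. (1.6) (v)] -/
theorem unitsMap_extendedHom_toPrincipalIdeal [NumberField L] (k : Kˣ) :
    Units.map (extendedHom L (𝓞 L) : FractionalIdeal (𝓞 K)⁰ K →+* FractionalIdeal (𝓞 L)⁰ L).toMonoidHom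
        (toPrincipalIdeal (𝓞 K) K k) = toPrincipalIdeal (𝓞 L) L (unitsIncl K L k) := by
  apply Units.ext
  rw [Units.coe_map, coe_toPrincipalIdeal, coe_toPrincipalIdeal, RingHom.toMonoidHom_eq_coe, MonoidHom.coe_coe,
    extendedHom_spanSingleton_eq, coe_unitsIncl]

/-- **`ιP_K⁺ = π(K⁺)`**: the extension of the totally positive principal ideals of `K` is the image under `π_L` of `K⁺ ↪ Lˣ`.
[cite: NeukirchANT1999, Ch. III §1 Prop. (1.6) (v)] -/
theorem map_extendedHom_totPosPrincipalIdeals_eq :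
    (totPosPrincipalIdeals K).map (Units.map (extendedHom L (𝓞 L) :
        FractionalIdeal (𝓞 K)⁰ K →+* FractionalIdeal (𝓞 L)⁰ L).toMonoidHom) =
      (((signHom K).ker).map (unitsIncl K L)).map (toPrincipalIdeal (𝓞 L) L) := by
  rw [totPosPrincipalIdeals_eq_map, Subgroup.map_map, Subgroup.map_map]
  congr 1
  ext k : 1
  exact unitsMap_extendedHom_toPrincipalIdeal k

/-! ### §2 (1⁺) `#Cl⁺(L)^G = [𝓘_L^G : P⁺^G] · #H¹(G, P⁺)` — for any `G`-stable subgroup `P` of `𝓘_L` -/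

/-- **The connecting homomorphism in index form, for ANY `G`-stable `P ≤ 𝓘_L`** (`Aut(L/K) = ⟨σ⟩`):
`[{I : σI/I ∈ P} : 𝓘_L^G · P] = #Ĥ⁻¹(G, P)`, by the map `σ − 1` and **`H¹(G, 𝓘_L) = 0`** (tree
`AmbiguousIdeal.exists_smul_div_eq_of_norm_eq_one`); the wide `relIndex_sup_z0_eq_h1_principals` is the case `P = P_L`.
[cite: Lang1990, Ch. 13 §4, proof of Lemma 4.1, eq. (1) (PDF pp. 203–204)] -/
theorem relIndex_sup_z0_eq_h1_of_isStable {σ : L ≃ₐ[K] L}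
    (hσ : ∀ τ : L ≃ₐ[K] L, τ ∈ Subgroup.zpowers σ) {P : Subgroup (FractionalIdeal (𝓞 L)⁰ L)ˣ}
    (hP : IsStable (L ≃ₐ[K] L) P) :
    (z0 σ (⊤ : Subgroup (FractionalIdeal (𝓞 L)⁰ L)ˣ) ⊥ ⊔ P).relIndex (z0 σ ⊤ P) = h1 σ P ⊥ := by
  have hPZ : P ≤ z0 σ ⊤ P := fun p hp =>
    mem_z0.mpr ⟨Subgroup.mem_top p, P.div_mem (hP σ hp) hp⟩
  have hIGZ : z0 σ (⊤ : Subgroup (FractionalIdeal (𝓞 L)⁰ L)ˣ) ⊥ ≤ z0 σ ⊤ P := z0_mono bot_le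
  have hle : z0 σ (⊤ : Subgroup (FractionalIdeal (𝓞 L)⁰ L)ˣ) ⊥ ⊔ P ≤ z0 σ ⊤ P := sup_le hIGZ hPZ
  have hker : (twist σ : (FractionalIdeal (𝓞 L)⁰ L)ˣ →* _).ker ⊓ z0 σ ⊤ P ≤
      z0 σ (⊤ : Subgroup (FractionalIdeal (𝓞 L)⁰ L)ˣ) ⊥ ⊔ P := by
    intro I hI
    obtain ⟨hI1, -⟩ := Subgroup.mem_inf.mp hI
    rw [MonoidHom.mem_ker, twist_eq_one_iff] at hI1
    exact Subgroup.mem_sup_left (mem_z0_bot.mpr ⟨Subgroup.mem_top I, hI1⟩)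
  rw [← relIndex_map_map_of_ker_inf_le (twist σ) hle hker]
  have h1 : (z0 σ (⊤ : Subgroup (FractionalIdeal (𝓞 L)⁰ L)ˣ) ⊥ ⊔ P).map (twist σ) = b1 σ P ⊥ := by
    rw [Subgroup.map_sup, b1_bot, (Subgroup.map_eq_bot_iff _).mpr ?_, bot_sup_eq]
    intro I hI
    rw [MonoidHom.mem_ker, twist_eq_one_iff]
    exact (mem_z0_bot.mp hI).2
  have h2 : (z0 σ ⊤ P).map (twist σ) = z1 (L ≃ₐ[K] L) P ⊥ := by
    apply le_antisymm
    · rintro _ ⟨I, hI, rfl⟩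
      exact mem_z1_bot.mpr ⟨(mem_z0.mp hI).2, norm_twist σ I⟩
    · intro p hp
      obtain ⟨hpP, hN⟩ := mem_z1_bot.mp hp
      obtain ⟨J, hJ⟩ := exists_smul_div_eq_of_norm_eq_one hσ hN
      refine ⟨J, mem_z0.mpr ⟨Subgroup.mem_top J, ?_⟩, hJ⟩
      rw [hJ]
      exact hpP
  rw [h1, h2, h1_def]

/-- **(1⁺) `[z0 σ ⊤ P : P] = [𝓘_L^G : P ∩ 𝓘_L^G] · #Ĥ⁻¹(G, P)`** for any `G`-stable `P ≤ 𝓘_L` (`Aut(L/K) = ⟨σ⟩`): the number of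
`σ`-fixed classes of `𝓘_L/P` in index form (`0 → 𝓘^G/P^G → (𝓘/P)^G → H¹(G, P) → H¹(G, 𝓘) = 0`).  At `P = P⁺ = totPosPrincipalIdeals L`
this counts the AMBIGUOUS NARROW CLASSES. [cite: Lang1990, Ch. 13 §4, proof of Lemma 4.1, eq. (1) (PDF p. 204)]
[cite: Yu2014AmbiguousClassNumberFormulas, Thm. 1.1 (proof)] -/
theorem relIndex_z0_eq_relIndex_mul_h1_of_isStable {σ : L ≃ₐ[K] L}
    (hσ : ∀ τ : L ≃ₐ[K] L, τ ∈ Subgroup.zpowers σ) {P : Subgroup (FractionalIdeal (𝓞 L)⁰ L)ˣ}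
    (hP : IsStable (L ≃ₐ[K] L) P) :
    P.relIndex (z0 σ ⊤ P) = P.relIndex (z0 σ (⊤ : Subgroup (FractionalIdeal (𝓞 L)⁰ L)ˣ) ⊥) * h1 σ P ⊥ := by
  have hPZ : P ≤ z0 σ ⊤ P := fun p hp =>
    mem_z0.mpr ⟨Subgroup.mem_top p, P.div_mem (hP σ hp) hp⟩
  have hIGZ : z0 σ (⊤ : Subgroup (FractionalIdeal (𝓞 L)⁰ L)ˣ) ⊥ ≤ z0 σ ⊤ P := z0_mono bot_le
  have hmul := Subgroup.relIndex_mul_relIndex P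
    (z0 σ (⊤ : Subgroup (FractionalIdeal (𝓞 L)⁰ L)ˣ) ⊥ ⊔ P) (z0 σ ⊤ P) le_sup_right (sup_le hIGZ hPZ)
  rw [← hmul, relIndex_sup_z0_eq_h1_of_isStable hσ hP, Subgroup.relIndex_sup_right]

/-! ### §3 (3⁺) `[P⁺^G : ιP_K⁺] = #Ĥ⁻¹(G, E⁺)` and (4⁺) `#Ĥ⁻¹(G, P⁺) = [E_K⁺ ∩ N L⁺ : N E⁺]` -/

omit [NumberField K] in
/-- `P⁺^G = π{a ∈ L⁺ : σa/a ∈ E⁺}` (`π : a ↦ (a)` has kernel `E`, and `E ∩ L⁺ = E⁺`): narrow twin of `z0_principals_bot_eq_map`.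
[cite: Lang1990, Ch. 13 §4, proof of Lemma 4.1 (PDF p. 204)] -/
theorem z0_totPosPrincipalIdeals_bot_eq_map (σ : L ≃ₐ[K] L) :
    z0 σ (totPosPrincipalIdeals L) ⊥ =
      (z0 σ (signHom L).ker (unitsE L ⊓ (signHom L).ker)).map (toPrincipalIdeal (𝓞 L) L) := by
  have hπ : ∀ (g : L ≃ₐ[K] L) (a : Lˣ),
      toPrincipalIdeal (𝓞 L) L (g • a) = g • toPrincipalIdeal (𝓞 L) L a := toPrincipalIdeal_smul
  have h := z0_map_eq (σ := σ) (A := (signHom L).ker) (C := unitsE L ⊓ (signHom L).ker) (toPrincipalIdeal (𝓞 L) L) hπ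
    isStable_ker_signHom inf_le_right (by rw [ker_toPrincipalIdeal_eq_unitsE, inf_comm])
  rw [(Subgroup.map_eq_bot_iff (unitsE L ⊓ (signHom L).ker)).mpr
    (by rw [ker_toPrincipalIdeal_eq_unitsE]; exact inf_le_left)] at h
  rw [totPosPrincipalIdeals_eq_map]
  exact h

omit [NumberField K] in
/-- `P⁺^G = P⁺ ∩ 𝓘_L^G` (`z0 σ P⁺ ⊥ = P⁺ ⊓ z0 σ ⊤ ⊥`). [cite: Lang1990, Ch. 13 §4, proof of Lemma 4.1, eq. (2) (PDF p. 203)] -/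
theorem z0_totPosPrincipalIdeals_bot_eq_inf (σ : L ≃ₐ[K] L) :
    z0 σ (totPosPrincipalIdeals L) ⊥ = totPosPrincipalIdeals L ⊓ z0 σ (⊤ : Subgroup (FractionalIdeal (𝓞 L)⁰ L)ˣ) ⊥ := by
  ext I
  rw [mem_z0_bot, Subgroup.mem_inf, mem_z0_bot]
  simp only [Subgroup.mem_top, true_and]

/-- `ιP_K⁺ ≤ P⁺^G`: totally positive principal ideals extended from `K` are ambiguous and totally positive.
[cite: Lang1990, Ch. 13 §4, proof of Lemma 4.1 (PDF p. 203)] -/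
theorem map_totPosPrincipalIdeals_le_z0 (σ : L ≃ₐ[K] L) :
    (totPosPrincipalIdeals K).map (Units.map (extendedHom L (𝓞 L) :
        FractionalIdeal (𝓞 K)⁰ K →+* FractionalIdeal (𝓞 L)⁰ L).toMonoidHom) ≤
      z0 σ (totPosPrincipalIdeals L) ⊥ := by
  rw [map_extendedHom_totPosPrincipalIdeals_eq, z0_totPosPrincipalIdeals_bot_eq_map]
  refine Subgroup.map_mono ?_
  intro k hk
  refine mem_z0.mpr ⟨map_unitsIncl_ker_signHom_le hk, ?_⟩
  obtain ⟨k₀, -, rfl⟩ := hk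
  rw [smul_unitsIncl, div_self']
  exact Subgroup.one_mem _

/-- **(3⁺) `[P⁺^G : ιP_K⁺] = #Ĥ⁻¹(G, E⁺)`** for `L/K` cyclic, unramified at the infinite places: along `π : a ↦ (a)` (kernel `E`,
`E ∩ L⁺ = E⁺`) the index `[π{a ∈ L⁺ : σa/a ∈ E⁺} : π(K⁺)]` equals `[{a ∈ L⁺ : σa/a ∈ E⁺} : K⁺E⁺] = #Ĥ⁻¹(G, E⁺)`
(`relIndex_z0_kerSign_unitsPos_eq_h1`). [cite: Lang1990, Ch. 13 §4, proof of Lemma 4.1, eq. (3) (PDF p. 204)]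
[cite: Yu2014AmbiguousClassNumberFormulas, Thm. 1.1 (proof)] -/
theorem relIndex_map_totPosPrincipalIdeals_z0_eq_h1 [IsGalois K L] [IsUnramifiedAtInfinitePlaces K L] {σ : L ≃ₐ[K] L}
    (hσ : ∀ τ : L ≃ₐ[K] L, τ ∈ Subgroup.zpowers σ) :
    ((totPosPrincipalIdeals K).map (Units.map (extendedHom L (𝓞 L) :
        FractionalIdeal (𝓞 K)⁰ K →+* FractionalIdeal (𝓞 L)⁰ L).toMonoidHom)).relIndex
        (z0 σ (totPosPrincipalIdeals L) ⊥) = h1 σ (unitsE L ⊓ (signHom L).ker) ⊥ := by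
  have hEle : unitsE L ⊓ (signHom L).ker ≤ z0 σ (signHom L).ker (unitsE L ⊓ (signHom L).ker) := fun e he =>
    mem_z0.mpr ⟨he.2, (unitsE L ⊓ (signHom L).ker).div_mem (isStable_unitsE_inf_ker_signHom σ he) he⟩
  have hKle : ((signHom K).ker).map (unitsIncl K L) ≤ z0 σ (signHom L).ker (unitsE L ⊓ (signHom L).ker) := by
    rintro _ ⟨k, hk, rfl⟩
    refine mem_z0.mpr ⟨map_unitsIncl_ker_signHom_le ⟨k, hk, rfl⟩, ?_⟩
    rw [smul_unitsIncl, div_self']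
    exact Subgroup.one_mem _
  have hle : (unitsE L ⊓ (signHom L).ker) ⊔ ((signHom K).ker).map (unitsIncl K L) ≤
      z0 σ (signHom L).ker (unitsE L ⊓ (signHom L).ker) := sup_le hEle hKle
  have hkerle : (toPrincipalIdeal (𝓞 L) L).ker ⊓ z0 σ (signHom L).ker (unitsE L ⊓ (signHom L).ker) ≤
      (unitsE L ⊓ (signHom L).ker) ⊔ ((signHom K).ker).map (unitsIncl K L) := by
    rw [ker_toPrincipalIdeal_eq_unitsE]
    intro e he
    exact Subgroup.mem_sup_left ⟨he.1, z0_le he.2⟩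
  rw [map_extendedHom_totPosPrincipalIdeals_eq, z0_totPosPrincipalIdeals_bot_eq_map, ← relIndex_z0_kerSign_unitsPos_eq_h1 hσ,
    ← relIndex_map_map_of_ker_inf_le _ hle hkerle, Subgroup.map_sup,
    (Subgroup.map_eq_bot_iff (unitsE L ⊓ (signHom L).ker)).mpr
      (by rw [ker_toPrincipalIdeal_eq_unitsE]; exact inf_le_left), bot_sup_eq]

/-- **(4⁺) `#Ĥ⁻¹(G, P⁺) = [E⁺ ∩ N(L⁺) : N(E⁺)]`** for `L/K` cyclic: along `π`, `P⁺ ≅ L⁺/E⁺`, so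
`#Ĥ⁻¹(G, P⁺) = [{a ∈ L⁺ : N a ∈ E⁺} : E⁺·(σ − 1)L⁺]`; the norm map takes this pair onto `N E⁺ ≤ E⁺ ∩ N L⁺` with kernel
`{a ∈ L⁺ : N a = 1} = (σ − 1)L⁺` (§1).  Narrow twin of `h1_principals_eq_relIndex`.
[cite: Lang1990, Ch. 13 §4, proof of Lemma 4.1, eq. (4) (PDF p. 204)] [cite: Yu2014AmbiguousClassNumberFormulas, Thm. 1.1 (proof)] -/
theorem h1_totPosPrincipalIdeals_eq_relIndex [IsGalois K L] {σ : L ≃ₐ[K] L}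
    (hσ : ∀ τ : L ≃ₐ[K] L, τ ∈ Subgroup.zpowers σ) :
    h1 σ (totPosPrincipalIdeals L) ⊥ =
      ((unitsE L ⊓ (signHom L).ker).map (Herbrand.norm (L ≃ₐ[K] L))).relIndex
        ((unitsE L ⊓ (signHom L).ker) ⊓ ((signHom L).ker).map (Herbrand.norm (L ≃ₐ[K] L))) := by
  -- (a) along `π`
  have hπ : ∀ (g : L ≃ₐ[K] L) (a : Lˣ),
      toPrincipalIdeal (𝓞 L) L (g • a) = g • toPrincipalIdeal (𝓞 L) L a := toPrincipalIdeal_smul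
  have ha : h1 σ (totPosPrincipalIdeals L) ⊥ = h1 σ (signHom L).ker (unitsE L ⊓ (signHom L).ker) := by
    have h := h1_map_eq (σ := σ) (toPrincipalIdeal (𝓞 L) L) hπ isStable_ker_signHom isStable_unitsE_inf_ker_signHom
      inf_le_right (by rw [ker_toPrincipalIdeal_eq_unitsE, inf_comm])
    rw [← totPosPrincipalIdeals_eq_map, (Subgroup.map_eq_bot_iff (unitsE L ⊓ (signHom L).ker)).mpr
      (by rw [ker_toPrincipalIdeal_eq_unitsE]; exact inf_le_left)] at h
    exact h
  rw [ha, h1_def]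
  -- (b) the norm map
  set N : Lˣ →* Lˣ := Herbrand.norm (L ≃ₐ[K] L) with hN
  have hBA : b1 σ (signHom L).ker (unitsE L ⊓ (signHom L).ker) ≤ z1 (L ≃ₐ[K] L) (signHom L).ker (unitsE L ⊓ (signHom L).ker) :=
    b1_le_z1 isStable_ker_signHom isStable_unitsE_inf_ker_signHom inf_le_right
  have hker : N.ker ⊓ z1 (L ≃ₐ[K] L) (signHom L).ker (unitsE L ⊓ (signHom L).ker) ≤
      b1 σ (signHom L).ker (unitsE L ⊓ (signHom L).ker) := by
    intro a ha'
    obtain ⟨ha1, ha2⟩ := Subgroup.mem_inf.mp ha'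
    rw [MonoidHom.mem_ker, hN] at ha1
    obtain ⟨b, hb, hba⟩ := exists_mem_ker_signHom_smul_div_eq hσ (z1_le ha2) ha1
    exact mem_b1.mpr ⟨1, Subgroup.one_mem _, b, hb, by rw [one_mul]; exact hba⟩
  rw [← relIndex_map_map_of_ker_inf_le N hBA hker]
  have h1 : (z1 (L ≃ₐ[K] L) (signHom L).ker (unitsE L ⊓ (signHom L).ker)).map N =
      (unitsE L ⊓ (signHom L).ker) ⊓ ((signHom L).ker).map N := by
    ext x
    constructor
    · rintro ⟨a, ha', rfl⟩
      exact ⟨(mem_z1.mp ha').2, ⟨a, (mem_z1.mp ha').1, rfl⟩⟩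
    · rintro ⟨hxE, ⟨a, haP, rfl⟩⟩
      exact ⟨a, mem_z1.mpr ⟨haP, hxE⟩, rfl⟩
  have h2 : (b1 σ (signHom L).ker (unitsE L ⊓ (signHom L).ker)).map N = (unitsE L ⊓ (signHom L).ker).map N := by
    apply le_antisymm
    · rintro _ ⟨x, hx, rfl⟩
      obtain ⟨c, hc, a', -, rfl⟩ := mem_b1.mp hx
      refine ⟨c, hc, ?_⟩
      rw [map_mul, hN, norm_twist, mul_one]
    · exact Subgroup.map_mono le_b1
  rw [h1, h2]

/-! ### §5 `[𝓘_L^G : ιP_K⁺] = h⁺(K) · ∏_𝔭 e_𝔭` and the formula -/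

/-- **`[𝓘_L^G : ιP_K⁺] = h⁺(K) · ∏_𝔭 e_𝔭`** for `L/K` Galois with cyclic group `⟨σ⟩`: the chain `ιP_K⁺ ≤ ιP_K ≤ 𝓘_L^G` with
`[ιP_K : ιP_K⁺] = [P_K : P_K⁺]` (`ι` injective), the wide step (2) `[𝓘_L^G : ιP_K] = h_K · ∏_𝔭 e_𝔭`
(`relIndex_map_principals_z0_top_eq_mul`) and `h⁺_K = h_K · [P_K : P_K⁺]` (Fröhlich–Taylor (1.8)–(1.9)).
[cite: Lang1990, Ch. 13 §4, proof of Lemma 4.1, eq. (2) (PDF pp. 203–204)] [cite: FrohlichTaylor1990, Ch. V §1 (1.8)–(1.9), p. 163] -/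
theorem relIndex_map_totPosPrincipalIdeals_z0_top_eq_mul [IsGalois K L] {σ : L ≃ₐ[K] L}
    (hσ : ∀ τ : L ≃ₐ[K] L, τ ∈ Subgroup.zpowers σ) :
    ((totPosPrincipalIdeals K).map (Units.map (extendedHom L (𝓞 L) :
        FractionalIdeal (𝓞 K)⁰ K →+* FractionalIdeal (𝓞 L)⁰ L).toMonoidHom)).relIndex
        (z0 σ (⊤ : Subgroup (FractionalIdeal (𝓞 L)⁰ L)ˣ) ⊥) =
      narrowClassNumber K * ∏ᶠ v : HeightOneSpectrum (𝓞 K), v.asIdeal.ramificationIdxIn (𝓞 L) := by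
  set ι := (Units.map (extendedHom L (𝓞 L) :
        FractionalIdeal (𝓞 K)⁰ K →+* FractionalIdeal (𝓞 L)⁰ L).toMonoidHom) with hι
  have hinj : Function.Injective ι := by
    have hinj' : Function.Injective (extendedHom L (𝓞 L) :
        FractionalIdeal (𝓞 K)⁰ K →+* FractionalIdeal (𝓞 L)⁰ L) := extendedHom_injective (𝓞 K) K L (𝓞 L)
    exact Units.map_injective hinj'
  have h₁ : (totPosPrincipalIdeals K).map ι ≤ (principals K).map ι := Subgroup.map_mono (totPosPrincipalIdeals_le_range K)
  have h₂ : (principals K).map ι ≤ z0 σ (⊤ : Subgroup (FractionalIdeal (𝓞 L)⁰ L)ˣ) ⊥ :=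
    (Subgroup.map_le_range ι _).trans (range_unitsMap_extendedHom_le_z0 σ)
  rw [← Subgroup.relIndex_mul_relIndex _ _ _ h₁ h₂, Subgroup.relIndex_map_map_of_injective _ _ hinj,
    relIndex_map_principals_z0_top_eq_mul hσ, ← mul_assoc]
  congr 1
  rw [narrowClassNumber_eq_classNumber_mul_relIndex, mul_comm]

/-- **CHEVALLEY'S AMBIGUOUS CLASS NUMBER FORMULA FOR THE NARROW CLASS GROUP.**  Let `L/K` be a cyclic extension of number fields
with `G = Gal(L/K) = ⟨σ⟩`, UNRAMIFIED AT THE INFINITE PLACES (e.g. `L` totally real).  Then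

  `#Cl⁺(L)^G · [L : K] · [E_K⁺ : E_K⁺ ∩ N_G(L⁺)] = h⁺(K) · ∏_𝔭 e_𝔭`,

where `#Cl⁺(L)^G = [z0 σ ⊤ P⁺ : P⁺]` is the number of narrow ideal classes of `L` fixed by `G` (`P⁺ = totPosPrincipalIdeals L`),
`E_K⁺ = 𝓞_Lˣ ∩ L⁺ ∩ Kˣ` the totally positive units of `K` (inside `Lˣ`; `L⁺ = ker(signHom L)`), `N_G(L⁺)` the norms of totally
positive elements (`= E⁺ ∩ N_G(Lˣ)` on units, §6), `h⁺(K) = narrowClassNumber K`, and `e_𝔭` the ramification index of the finite prime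
`𝔭` of `K` in `L` (`∏ᶠ`, almost all `= 1`).  (The archimedean factor of the wide formula is `1` here.)  Assembly of §2–§5 exactly as in
the wide `card_fixed_mul_finrank_mul_relIndex_eq`. [cite: Gras2003, II.6.2.3 (restricted sense), IV.4]
[cite: Yu2014AmbiguousClassNumberFormulas, Thm. 1.1 (case `𝔠̃ = ∞̃_r`), p. 3] [cite: Lang1990, Ch. 13 §4, Lemma 4.1 (PDF pp. 203–204)] -/
theorem ambiguousNarrowClassNumberFormula [IsGalois K L] [IsUnramifiedAtInfinitePlaces K L] {σ : L ≃ₐ[K] L}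
    (hσ : ∀ τ : L ≃ₐ[K] L, τ ∈ Subgroup.zpowers σ) :
    (totPosPrincipalIdeals L).relIndex (z0 σ ⊤ (totPosPrincipalIdeals L)) * Module.finrank K L *
        ((unitsE L ⊓ (signHom L).ker) ⊓ ((signHom L).ker).map (Herbrand.norm (L ≃ₐ[K] L))).relIndex
          ((unitsE L ⊓ (signHom L).ker) ⊓ (unitsIncl K L).range) =
      narrowClassNumber K * ∏ᶠ v : HeightOneSpectrum (𝓞 K), v.asIdeal.ramificationIdxIn (𝓞 L) := by
  set c := (totPosPrincipalIdeals L).relIndex (z0 σ ⊤ (totPosPrincipalIdeals L)) with hc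
  set x := (totPosPrincipalIdeals L).relIndex (z0 σ (⊤ : Subgroup (FractionalIdeal (𝓞 L)⁰ L)ˣ) ⊥) with hx
  set y := ((unitsE L ⊓ (signHom L).ker).map (Herbrand.norm (L ≃ₐ[K] L))).relIndex
      ((unitsE L ⊓ (signHom L).ker) ⊓ ((signHom L).ker).map (Herbrand.norm (L ≃ₐ[K] L))) with hy
  set u := ((unitsE L ⊓ (signHom L).ker) ⊓ ((signHom L).ker).map (Herbrand.norm (L ≃ₐ[K] L))).relIndex
      ((unitsE L ⊓ (signHom L).ker) ⊓ (unitsIncl K L).range) with hu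
  have hE1 : c = x * h1 σ (totPosPrincipalIdeals L) ⊥ :=
    relIndex_z0_eq_relIndex_mul_h1_of_isStable hσ isStable_totPosPrincipalIdeals
  have hE4 : h1 σ (totPosPrincipalIdeals L) ⊥ = y := h1_totPosPrincipalIdeals_eq_relIndex hσ
  have hE0 : h0 σ (unitsE L ⊓ (signHom L).ker) ⊥ = y * u := h0_unitsPos_eq_relIndex_mul hσ
  obtain ⟨hunits, -⟩ := h1_unitsPos_eq_finrank_mul_h0 (K := K) (L := L) hσ
  -- `[𝓘^G : ιP_K⁺] = [𝓘^G : P⁺^G] · [P⁺^G : ιP_K⁺] = x · h1(E⁺)`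
  have hE23 : narrowClassNumber K * ∏ᶠ v : HeightOneSpectrum (𝓞 K), v.asIdeal.ramificationIdxIn (𝓞 L) =
      h1 σ (unitsE L ⊓ (signHom L).ker) ⊥ * x := by
    have h₁ : (totPosPrincipalIdeals K).map (Units.map (extendedHom L (𝓞 L) :
        FractionalIdeal (𝓞 K)⁰ K →+* FractionalIdeal (𝓞 L)⁰ L).toMonoidHom) ≤ z0 σ (totPosPrincipalIdeals L) ⊥ :=
      map_totPosPrincipalIdeals_le_z0 σ
    have h₂ : z0 σ (totPosPrincipalIdeals L) ⊥ ≤ z0 σ (⊤ : Subgroup (FractionalIdeal (𝓞 L)⁰ L)ˣ) ⊥ := by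
      rw [z0_totPosPrincipalIdeals_bot_eq_inf]; exact inf_le_right
    rw [← relIndex_map_totPosPrincipalIdeals_z0_top_eq_mul hσ, ← Subgroup.relIndex_mul_relIndex _ _ _ h₁ h₂,
      relIndex_map_totPosPrincipalIdeals_z0_eq_h1 hσ, z0_totPosPrincipalIdeals_bot_eq_inf, Subgroup.inf_relIndex_right]
  rw [hE23]
  calc c * Module.finrank K L * u
      = x * (Module.finrank K L * (y * u)) := by rw [hE1, hE4]; ring
    _ = x * h1 σ (unitsE L ⊓ (signHom L).ker) ⊥ := by rw [← hE0, ← hunits]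
    _ = h1 σ (unitsE L ⊓ (signHom L).ker) ⊥ * x := by ring

/-- The narrow unit index `[E_K⁺ : E_K⁺ ∩ N_G(L⁺)]` and the index `[E_K⁺ ∩ N_G(L⁺) : N_G(E⁺)]` are finite (non-zero): they divide
`#Ĥ⁰(G, E⁺) ≠ 0`. [cite: Lang1990, Ch. 13 §4, Lemma 4.1 (PDF p. 204)] -/
theorem relIndex_unitsPosNorm_ne_zero [IsGalois K L] [IsUnramifiedAtInfinitePlaces K L] {σ : L ≃ₐ[K] L}
    (hσ : ∀ τ : L ≃ₐ[K] L, τ ∈ Subgroup.zpowers σ) :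
    ((unitsE L ⊓ (signHom L).ker) ⊓ ((signHom L).ker).map (Herbrand.norm (L ≃ₐ[K] L))).relIndex
        ((unitsE L ⊓ (signHom L).ker) ⊓ (unitsIncl K L).range) ≠ 0 ∧
      ((unitsE L ⊓ (signHom L).ker).map (Herbrand.norm (L ≃ₐ[K] L))).relIndex
        ((unitsE L ⊓ (signHom L).ker) ⊓ ((signHom L).ker).map (Herbrand.norm (L ≃ₐ[K] L))) ≠ 0 := by
  obtain ⟨-, h0ne⟩ := h1_unitsPos_eq_finrank_mul_h0 (K := K) (L := L) hσ
  rw [h0_unitsPos_eq_relIndex_mul hσ] at h0ne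
  exact ⟨right_ne_zero_of_mul h0ne, left_ne_zero_of_mul h0ne⟩

end Literature.NumberTheory.NumberFields.AmbiguousClass

end
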